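import Summits.BirchSwinnertonDyer.BirchSwinnertonDyer.Theorems.SignedLowerHalvesSmallImageLowerHalfBothSignsRttCharRoadE1ScalarRealising
import Summits.BirchSwinnertonDyer.BirchSwinnertonDyer.Theorems.SignedLowerHalvesSmallImageLowerHalfBothSignsRttCharRoadE1ResidueEmbedding
import Summits.BirchSwinnertonDyer.BirchSwinnertonDyer.Theorems.SignedLowerHalvesSmallImageLowerHalfBothSignsRttCharRoadE1ResidualCharacterGlobal
import Mathlib.Algebra.Algebra.ZMod
import HarnessLib

/-!
# Route `SignedLowerHalves`, crux L `SmallImageLowerHalfBothSigns` (stmt-BirchSwinnertonDyer-23599), line `rtt_w3` v12 — glue INPUT (I5) `hs_S` of `injTop_of_inputs`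
# (p770240): GLOBAL `Γ_K`-EQUIVARIANCE OF THE COORDINATES ON `A_θ[π]` (GLUE memo `Lines/rtt_w3-GLUE-g7.md` §1(2) «hsS»; INPUT SPEC 10:26:53Z (I5)).

For the rank-one character module `M = Cofree θ F_S` (`g • m = θ(g)₀₀ • m`), an `𝒪_v`-linear coordinate `s : M →+ W_K[p^∞]` (honda: `s (ι_v b • m) = u_b (s m)`,
`ι_v (χ δ) = θ(res δ)₀₀`, `res δ • x = u_{χ δ} x`) is `Γ_K`-equivariant on `M[π]` as soon as the RESIDUAL CHARACTER IDENTITY `θ(τ)₀₀ ≡ ι_v(b_τ) (mod π)` holds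
for every `τ ∈ Γ_K`, `b_τ` a scalar realising `ρ̄(res τ) ∈ kˣ` on `W_K[p]`. That identity is E1-a (`residualChar_eq_or_eq_conj`, p763602) applied with the
residue embedding `emb : k →+* 𝒪_S/(π)` of `…E1ResidueEmbedding` (χ := `emb ∘ Φ ∘ ρ̄`, `lam := emb y`), its conjugate branch being excluded at the non-scalar
local element `δ₀` (honda's witness `hw`, p770405): there the identity holds by `ι_v (χ δ₀) = θ(res δ₀)₀₀`, and the conjugate value would force `ρ̄(res δ₀)`
to be Frobenius-fixed, i.e. scalar (`conj_eq_or_conj_eq_of_mem_normalizer`, `p` odd).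

Width seat `bsd-line-slh-p3-w3` g18 under LEAD `cruxlead-stmt-BirchSwinnertonDyer-23599` (cell `bsd-ssimc`; `--supports stmt-BirchSwinnertonDyer-23599 --as helper`).
THEOREMS ONLY (no definition, no named fact, no instance, no `sorry`). INPUTS as hypotheses in honda's shapes (p768833/p768892/p769355) plus `hw` and the
faithfulness `hfaith` (both p770405). BSD / crux L / INJ_top are NOT proved here.

* ★★★ `residualChar_sub_mem_of_inputs` — the residual character identity `θ(τ)₀₀ − ι_v b ∈ (π)` for every `τ ∈ Γ_K` and every `b` realising `ρ̄(res τ)`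
  on `W_K[p]`.
* ★★★ `coord_smul_of_inputs` — `hs_S` (VERBATIM shape of `injTop_of_inputs`, per coordinate): `∀ g m, m ∈ Sπ → s (g • m) = g • s m`.

References: [Serre1972] §2.2, §4.2 c); [SerreAbelianLadic1968] I §2.3; [SerreLocalFields1979] IV §1; [LubinTate1965] §1.
-/

set_option autoImplicit false
set_option linter.dupNamespace false -- D-0017: single-problem summit, the namespace repeats the problem name by design
noncomputable section

open scoped Classical MatrixGroups NumberField

namespace Summit.BirchSwinnertonDyer.BirchSwinnertonDyer.Theorems.SmallImageCharSignedSelmer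

open NumberField IsDedekindDomain Field Literature.NumberTheory.GaloisRepresentations Literature.NumberTheory.GaloisRepresentations.Serre1972
  Literature.NumberTheory.EllipticCurves Literature.NumberTheory.EllipticCurves.GreenbergSelmer WeierstrassCurve Matrix
  Literature.NumberTheory.LFunctions
  Summit.BirchSwinnertonDyer.BirchSwinnertonDyer.Theorems.SmallImageRttCharRoad
  Summit.BirchSwinnertonDyer.BirchSwinnertonDyer.Theorems.SmallImageLambdaLowerThreeNsThetaPartner

/-! ## The residual character identity and `hs_S` -/

section Global

variable (W : WeierstrassCurve ℚ) [W.IsElliptic] [W.IsGloballyMinimal] {p : ℕ} [Fact p.Prime]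
  (Φ : Multiplicative (AddAut (geomTorsion W p)) ≃* GL (Fin 2) (ZMod p))
  {k : Subalgebra (ZMod p) (Matrix (Fin 2) (Fin 2) (ZMod p))}
  (K : Type) [Field K] [NumberField K]

/-- ★★★ **The residual character identity (E1-a, branch resolved).** In the setting of `residualChar_eq_or_eq_conj` (the crux pair, `K` quadratic with
`ρ̄(Γ_K) ⊆ kˣ`, the Hecke character `ψ` of conductor `𝔪` and its `p`-adic avatar `θ`), with honda's formal-module data on `W_K[p^∞]` (scalars `uK`, Lubin–Tate
values `χLT` through which `Γ_{K_v}` acts, the coefficient embedding `ι_v` with `ι_v (χLT δ) = θ(res δ)₀₀`, a non-scalar witness `δ₀`, faithfulness mod `p`), an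
element `c` with `ρ̄(c) ∉ kˣ`, and an irreducible `π ∈ 𝒪_S`: for every `τ ∈ Γ_K` and every scalar `b` realising `τ` on `W_K[p]`,
`θ(τ)₀₀ − ι_v b ∈ (π)`. [cite: Serre1972, §2.2, §4.2 c)] [cite: SerreAbelianLadic1968, Ch. I §2.3] -/
theorem residualChar_sub_mem_of_inputs (hp2 : p ≠ 2) (hk : IsField k) (h2k : Module.finrank (ZMod p) k = 2)
    (e₀ : geomTorsion W p ≃+ (Fin 2 → ZMod p))
    (he₀ : ∀ (g : Multiplicative (AddAut (geomTorsion W p))) (x : geomTorsion W p),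
      e₀ (Multiplicative.toAdd g x) = ((Φ g : GL (Fin 2) (ZMod p)) : Matrix (Fin 2) (Fin 2) (ZMod p)) *ᵥ e₀ x)
    (htr : letI : Module (ZMod p) (geomTorsion W p) := AddSubgroup.torsionBy.zmodModule
      ∀ g : Multiplicative (AddAut (geomTorsion W p)),
        Matrix.trace ((Φ g : GL (Fin 2) (ZMod p)) : Matrix (Fin 2) (Fin 2) (ZMod p)) =
          LinearMap.trace (ZMod p) (geomTorsion W p) ((Multiplicative.toAdd g).toAddMonoidHom.toZModLinearMap p))
    (hGN : (galoisRepTorsion W p).range.map Φ.toMonoidHom ≤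
      Subgroup.normalizer (Serre1972.unitGroup k : Set (GL (Fin 2) (ZMod p))))
    (hK2 : Module.finrank ℚ K = 2)
    (hKU : ∀ τ : absoluteGaloisGroup K, Φ (galoisRepTorsion W p (absGaloisRestrict ℚ K τ)) ∈ Serre1972.unitGroup k)
    (𝔪 : Ideal (𝓞 K)) (h𝔪 : 𝔪 ≠ ⊥) (ψ : HeightOneSpectrum (𝓞 K) → ℂ) (e : PadicAlgCl p ≃+* ℂ)
    (hneb : ∀ n : ℕ, Odd n → n.Coprime ((NumberField.discr K).natAbs * Ideal.absNorm 𝔪) →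
      idealPow K ψ (Ideal.span {(n : 𝓞 K)}) = (jacobiSym (NumberField.discr K) n : ℂ) * (n : ℂ) ^ (2 - 1))
    (htrace : ∀ (ℓ : ℕ) [Fact ℓ.Prime], ℓ ≠ p → W.HasGoodReductionAtPrime ℓ →
      ‖e.symm (∑ᶠ (w : HeightOneSpectrum (𝓞 K)) (_ : Ideal.absNorm w.asIdeal = ℓ), ψ w) -
        (W.frobeniusTrace ℓ : PadicAlgCl p)‖ < 1)
    {S : Set (PadicAlgCl p)} [FiniteDimensional ℚ_[p] (padicCoeffField S)] (θ : FramedGaloisRep K (padicCoeffIntegers S) 1)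
    (hθ : ∀ w : HeightOneSpectrum (𝓞 K), (p : 𝓞 K) ∉ w.asIdeal → ¬ 𝔪 ≤ w.asIdeal →
      θ.IsUnramifiedAt w ∧ ∃ P : Polynomial (padicCoeffIntegers S),
        P.map (padicCoeffIntegers S).subtype = Polynomial.X - Polynomial.C (e.symm (ψ w)) ∧ θ.HasFrobCharpolyAt w P)
    (c : absoluteGaloisGroup ℚ) (hc : Φ (galoisRepTorsion W p c) ∉ Serre1972.unitGroup k)
    {R : Type*} [CommRing R] (uK : R → ((W.baseChange K).geomPrimaryTorsion p →+ (W.baseChange K).geomPrimaryTorsion p))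
    (hadd : ∀ (a b : R) (x : (W.baseChange K).geomPrimaryTorsion p), uK (a + b) x = uK a x + uK b x)
    (hmul : ∀ (a b : R) (x : (W.baseChange K).geomPrimaryTorsion p), uK (a * b) x = uK a (uK b x))
    (hone : ∀ x : (W.baseChange K).geomPrimaryTorsion p, uK 1 x = x)
    {E' : Type} [Field E'] [Algebra K E'] (ι : AlgebraicClosure K →ₐ[K] AlgebraicClosure E') (χLT : absoluteGaloisGroup E' → R)
    (hχ : ∀ (δ : absoluteGaloisGroup E') (x : (W.baseChange K).geomPrimaryTorsion p), resGalOfEmb ι δ • x = uK (χLT δ) x)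
    (ιv : R →+* padicCoeffIntegers S)
    (hιv : ∀ δ : absoluteGaloisGroup E', ιv (χLT δ) =
      (((θ (resGalOfEmb ι δ) : GL (Fin 1) (padicCoeffIntegers S)) : Matrix (Fin 1) (Fin 1) (padicCoeffIntegers S)) 0 0))
    (hw : ∃ δ₀ : absoluteGaloisGroup E', ∀ n : ℕ, ∃ x : (W.baseChange K).geomPrimaryTorsion p, p • x = 0 ∧ uK (χLT δ₀) x ≠ n • x)
    (hfaith : ∀ d : R, (∀ x : (W.baseChange K).geomPrimaryTorsion p, p • x = 0 → uK d x = 0) → ∃ d' : R, d = (p : R) * d')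
    {π : padicCoeffIntegers S} (hπ : Irreducible π)
    (τ : absoluteGaloisGroup K) (b : R) (hb : ∀ x : (W.baseChange K).geomPrimaryTorsion p, p • x = 0 → uK b x = τ • x) :
    (((θ τ : GL (Fin 1) (padicCoeffIntegers S)) : Matrix (Fin 1) (Fin 1) (padicCoeffIntegers S)) 0 0) - ιv b ∈ Ideal.span {π} := by
  have hpp : p.Prime := Fact.out
  -- (1) the restricted scalars on `W_K[p]`, the non-scalar local element `τ₀ = res δ₀`, faithfulness
  obtain ⟨u', hu', hadd', hmul', hone', -, hthrough, hwit⟩ := exists_torsionRestrict (W.baseChange K) p uK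
  obtain ⟨δ₀, hδ₀⟩ := hw
  set τ₀ : absoluteGaloisGroup K := resGalOfEmb ι δ₀ with hτ₀def
  set fr := (torsionBaseChangeEquiv K W p).symm.trans e₀ with hfr
  have hτ₀act : ∀ Q : geomTorsion (W.baseChange K) p, τ₀ • Q = u' (χLT δ₀) Q := hthrough τ₀ (χLT δ₀) (fun x ↦ hχ δ₀ x)
  have hwit' : ∀ n : ℕ, ∃ Q : geomTorsion (W.baseChange K) p, u' (χLT δ₀) Q ≠ n • Q := fun n ↦ hwit (χLT δ₀) n (hδ₀ n)
  set z₀ : Matrix (Fin 2) (Fin 2) (ZMod p) :=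
    ((Φ (galoisRepTorsion W p (absGaloisRestrict ℚ K τ₀)) : GL (Fin 2) (ZMod p)) : Matrix (Fin 2) (Fin 2) (ZMod p)) with hz₀def
  have hz₀k : z₀ ∈ k := hKU τ₀
  have hz₀s : ∀ c : ZMod p, z₀ ≠ c • 1 :=
    coords_ne_smul_one_of_forall_exists_ne_nsmul fr (fun Q ↦ τ₀ • Q) (coords_smul_baseChange K W Φ e₀ he₀ τ₀) (fun n ↦ by
      obtain ⟨Q, hQ⟩ := hwit' n
      exact ⟨Q, by rw [hτ₀act]; exact hQ⟩)
  have hcomm : ∀ (r : R) (Q : geomTorsion (W.baseChange K) p), u' r (τ₀ • Q) = τ₀ • u' r Q := fun r Q ↦ by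
    rw [hτ₀act, hτ₀act, ← hmul' hmul, mul_comm, hmul' hmul]
  have hr₀ : ∀ c : ZMod p, ∃ Q : geomTorsion (W.baseChange K) p, fr (u' (χLT δ₀) Q) ≠ c • fr Q :=
    coords_ne_smul_of_ne_nsmul _ (u' (χLT δ₀)) hwit'
  have hfaith' : ∀ d : R, (∀ Q : geomTorsion (W.baseChange K) p, u' d Q = 0) → ∃ d' : R, d = (p : R) * d' := by
    intro d hd
    refine hfaith d fun x hx ↦ ?_
    have hxmem : (x : (W.baseChange K).geomPoints) ∈ geomTorsion (W.baseChange K) p := by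
      rw [mem_geomTorsion_iff, natCast_zsmul]
      change (((p • x : (W.baseChange K).geomPrimaryTorsion p)) : (W.baseChange K).geomPoints) = 0
      rw [hx]; rfl
    have hxQ : AddSubgroup.inclusion (geomTorsion_le_geomPrimaryTorsion (W.baseChange K) p) ⟨(x : (W.baseChange K).geomPoints), hxmem⟩ = x :=
      Subtype.ext rfl
    rw [← hxQ, ← hu', hd, map_zero]
  -- (2) the residue field `k' = 𝒪_S/(π)`, `r`, `ιr = r ∘ ι_v`, the residue embedding `emb`
  haveI hmax : (Ideal.span {π}).IsMaximal := isMaximal_span_singleton_of_irreducible hπ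
  letI : Field (padicCoeffIntegers S ⧸ Ideal.span {π}) := Ideal.Quotient.field (Ideal.span {π})
  set r : padicCoeffIntegers S →+* padicCoeffIntegers S ⧸ Ideal.span {π} := Ideal.Quotient.mk (Ideal.span {π}) with hrdef
  have hrp : r ((p : ℕ) : padicCoeffIntegers S) = 0 :=
    (Ideal.Quotient.eq_zero_iff_mem).2 (natCast_mem_span_singleton_of_irreducible (S := S) hπ)
  have hιrp : (r.comp ιv) (p : R) = 0 := by rw [RingHom.comp_apply, map_natCast]; exact hrp
  obtain ⟨emb, hemb⟩ := exists_residueEmbedding k fr u' h2k hz₀k hz₀s (fun Q ↦ τ₀ • Q) (coords_smul_baseChange K W Φ e₀ he₀ τ₀)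
    (hadd' hadd) (hmul' hmul) (hone' hone) hcomm hr₀ hfaith' (r.comp ιv) hιrp
  haveI : CharP (padicCoeffIntegers S ⧸ Ideal.span {π}) p := (CharP.charP_iff_prime_eq_zero hpp).2 hrp
  letI : Algebra (ZMod p) (padicCoeffIntegers S ⧸ Ideal.span {π}) := ZMod.algebra _ p
  letI : Field k := hk.toField
  have hemb_inj : Function.Injective emb := emb.injective
  -- (3) E1-a's character `χ = emb ∘ Φ ∘ ρ̄` on `U = ρ̄⁻¹Φ⁻¹(kˣ)` and the root `lam = emb z₀`
  let χE : (Serre1972.unitGroup k).comap (Φ.toMonoidHom.comp (galoisRepTorsion W p)) →* (padicCoeffIntegers S ⧸ Ideal.span {π})ˣ :=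
    (Units.map (emb : k →* padicCoeffIntegers S ⧸ Ideal.span {π})).comp
      ((Serre1972.unitGroupEquiv k).toMonoidHom.comp
        (MonoidHom.subgroupComap (Φ.toMonoidHom.comp (galoisRepTorsion W p)) (Serre1972.unitGroup k)))
  have hχE : ∀ u : (Serre1972.unitGroup k).comap (Φ.toMonoidHom.comp (galoisRepTorsion W p)),
      ((χE u : (padicCoeffIntegers S ⧸ Ideal.span {π})ˣ) : padicCoeffIntegers S ⧸ Ideal.span {π}) =
        emb ⟨((Φ (galoisRepTorsion W p (u : absoluteGaloisGroup ℚ)) : GL (Fin 2) (ZMod p)) : Matrix (Fin 2) (Fin 2) (ZMod p)), u.2⟩ :=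
    fun u ↦ rfl
  have halg : emb.comp (algebraMap (ZMod p) k) = algebraMap (ZMod p) (padicCoeffIntegers S ⧸ Ideal.span {π}) := Subsingleton.elim _ _
  have hemb_smul : ∀ (a : ZMod p) (z : k), emb (a • z) = algebraMap (ZMod p) _ a * emb z := fun a z ↦ by
    rw [Algebra.smul_def, map_mul, ← halg, RingHom.comp_apply]
  have hχ : ∀ (u : (Serre1972.unitGroup k).comap (Φ.toMonoidHom.comp (galoisRepTorsion W p))) (a b' : ZMod p),
      ((Φ (galoisRepTorsion W p (u : absoluteGaloisGroup ℚ)) : GL (Fin 2) (ZMod p)) : Matrix (Fin 2) (Fin 2) (ZMod p)) =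
          a • (1 : Matrix (Fin 2) (Fin 2) (ZMod p)) + b' • z₀ →
        ((χE u : (padicCoeffIntegers S ⧸ Ideal.span {π})ˣ) : padicCoeffIntegers S ⧸ Ideal.span {π}) =
          algebraMap (ZMod p) _ a + algebraMap (ZMod p) _ b' * emb ⟨z₀, hz₀k⟩ := by
    intro u a b' hu
    rw [hχE]
    have hmem : (⟨((Φ (galoisRepTorsion W p (u : absoluteGaloisGroup ℚ)) : GL (Fin 2) (ZMod p)) : Matrix (Fin 2) (Fin 2) (ZMod p)), u.2⟩ : k) =
        a • (1 : k) + b' • ⟨z₀, hz₀k⟩ := Subtype.ext (by simpa using hu)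
    rw [hmem, map_add, hemb_smul, hemb_smul, map_one, mul_one]
  -- `r` kills the elements of norm `< 1`
  have hr : ∀ x : padicCoeffIntegers S, ‖(x : PadicAlgCl p)‖ < 1 → r x = 0 := fun x hx ↦
    (Ideal.Quotient.eq_zero_iff_mem).2 (mem_span_singleton_of_norm_lt_one hπ hx)
  -- (4) E1-a
  have hE1 := residualChar_eq_or_eq_conj W p Φ K hk h2k e₀ he₀ htr hGN hK2 hKU 𝔪 h𝔪 ψ e hneb htrace θ hθ r hr hz₀k hz₀s
    (emb ⟨z₀, hz₀k⟩) χE hχ c hc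
  -- the local identity at `τ₀`: `r θ(τ₀)₀₀ = emb z₀`
  have hz₀real : ∀ Q : geomTorsion (W.baseChange K) p, fr (u' (χLT δ₀) Q) = z₀ *ᵥ fr Q := fun Q ↦ by
    rw [← hτ₀act, coords_smul_baseChange K W Φ e₀ he₀ τ₀]
  have hloc : r ((((θ τ₀ : GL (Fin 1) (padicCoeffIntegers S)) : Matrix (Fin 1) (Fin 1) (padicCoeffIntegers S)) 0 0)) = emb ⟨z₀, hz₀k⟩ := by
    rw [hemb ⟨z₀, hz₀k⟩ (χLT δ₀) hz₀real, RingHom.comp_apply, hιv]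
  -- (5) the conjugate branch is impossible: it would make `z₀` Frobenius-fixed, hence scalar
  have hbranch : ∀ τ' : absoluteGaloisGroup K,
      r ((((θ τ' : GL (Fin 1) (padicCoeffIntegers S)) : Matrix (Fin 1) (Fin 1) (padicCoeffIntegers S)) 0 0)) =
        ((χE ⟨absGaloisRestrict ℚ K τ', hKU τ'⟩ : (padicCoeffIntegers S ⧸ Ideal.span {π})ˣ) : padicCoeffIntegers S ⧸ Ideal.span {π}) := by
    rcases hE1 with h | h
    · exact h
    · exfalso
      have h0 := h τ₀
      rw [hloc, hχE] at h0
      -- the conjugated matrix `C z₀ C⁻¹`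
      have hcN : Φ (galoisRepTorsion W p c) ∈ Subgroup.normalizer (Serre1972.unitGroup k : Set (GL (Fin 2) (ZMod p))) :=
        hGN ⟨galoisRepTorsion W p c, ⟨c, rfl⟩, rfl⟩
      have hconj : ((Φ (galoisRepTorsion W p (c * absGaloisRestrict ℚ K τ₀ * c⁻¹)) : GL (Fin 2) (ZMod p)) : Matrix (Fin 2) (Fin 2) (ZMod p)) =
          ((Φ (galoisRepTorsion W p c) : GL (Fin 2) (ZMod p)) : Matrix (Fin 2) (Fin 2) (ZMod p)) * z₀ *
            ((Φ (galoisRepTorsion W p c) : GL (Fin 2) (ZMod p)) : Matrix (Fin 2) (Fin 2) (ZMod p))⁻¹ := by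
        rw [map_mul, map_mul, map_inv, map_mul, map_mul, map_inv, Units.val_mul, Units.val_mul, Matrix.coe_units_inv]
      rcases conj_eq_or_conj_eq_of_mem_normalizer hk hz₀k hz₀s hcN with h1 | h1
      · exact hc (mem_unitGroup_of_conj_eq hz₀k hz₀s h1)
      · -- `z₀ = C z₀ C⁻¹ = tr z₀ • 1 - z₀` (injectivity of `emb`) ⇒ `2 z₀ = tr z₀ • 1`: scalar, contradiction
        have h3 : z₀ = z₀.trace • (1 : Matrix (Fin 2) (Fin 2) (ZMod p)) - z₀ := by
          have h0' := congrArg Subtype.val (hemb_inj h0)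
          change z₀ = ((Φ (galoisRepTorsion W p (c * absGaloisRestrict ℚ K τ₀ * c⁻¹)) : GL (Fin 2) (ZMod p)) :
            Matrix (Fin 2) (Fin 2) (ZMod p)) at h0'
          rw [hconj, h1] at h0'
          exact h0'
        have h4 : z₀ + z₀ = z₀.trace • (1 : Matrix (Fin 2) (Fin 2) (ZMod p)) := by
          nth_rewrite 2 [h3]
          rw [add_sub_cancel]
        have htwo : (2 : ZMod p) ≠ 0 := by
          intro h2'
          have h2n : ((2 : ℕ) : ZMod p) = 0 := by exact_mod_cast h2'
          exact hp2 ((Nat.prime_dvd_prime_iff_eq hpp Nat.prime_two).1 ((ZMod.natCast_eq_zero_iff 2 p).1 h2n))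
        apply hz₀s ((2 : ZMod p)⁻¹ * z₀.trace)
        rw [mul_smul, ← h4, ← two_smul (ZMod p) z₀, smul_smul, inv_mul_cancel₀ htwo, one_smul]
  -- (6) branch 1 at `τ`, with the given realiser `b`
  have hbreal : ∀ Q : geomTorsion (W.baseChange K) p,
      fr (u' b Q) = ((Φ (galoisRepTorsion W p (absGaloisRestrict ℚ K τ)) : GL (Fin 2) (ZMod p)) : Matrix (Fin 2) (Fin 2) (ZMod p)) *ᵥ fr Q := by
    intro Q
    have huQ : u' b Q = τ • Q := by
      apply AddSubgroup.inclusion_injective (geomTorsion_le_geomPrimaryTorsion (W.baseChange K) p)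
      rw [hu', hb _ (by
        apply Subtype.ext
        change ((p • (Q : (W.baseChange K).geomPoints))) = 0
        rw [← natCast_zsmul]; exact (mem_geomTorsion_iff _ _ _).1 Q.2)]
      exact Subtype.ext rfl
    rw [huQ, coords_smul_baseChange K W Φ e₀ he₀ τ]
  have hval := hbranch τ
  rw [hχE, hemb ⟨_, hKU τ⟩ b hbreal, RingHom.comp_apply] at hval
  rw [← Ideal.Quotient.eq_zero_iff_mem, map_sub, sub_eq_zero]
  exact hval

/-- ★★★ **`hsS`: global `Γ_K`-equivariance of an `𝒪_v`-linear coordinate on `A_θ[π]`.** In the setting of `residualChar_sub_mem_of_inputs`, every additive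
`s : A_θ → W_K[p^∞]` with `s (ι_v b • m) = u_b (s m)` (honda's `𝒪_v`-linearity) satisfies `s (g • m) = g • s m` for all `g ∈ Γ_K` and `m ∈ A_θ[π]`:
`g • m = θ(g)₀₀ • m = ι_v(b_g) • m` on `A_θ[π]` by the residual character identity, and `u_{b_g} = g` on `W_K[p] ∋ s m`.
[cite: Serre1972, §2.2, §4.2 c)] [cite: SerreAbelianLadic1968, Ch. I §2.3] -/
theorem coord_smul_of_inputs (hp2 : p ≠ 2) (hk : IsField k) (h2k : Module.finrank (ZMod p) k = 2)
    (e₀ : geomTorsion W p ≃+ (Fin 2 → ZMod p))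
    (he₀ : ∀ (g : Multiplicative (AddAut (geomTorsion W p))) (x : geomTorsion W p),
      e₀ (Multiplicative.toAdd g x) = ((Φ g : GL (Fin 2) (ZMod p)) : Matrix (Fin 2) (Fin 2) (ZMod p)) *ᵥ e₀ x)
    (htr : letI : Module (ZMod p) (geomTorsion W p) := AddSubgroup.torsionBy.zmodModule
      ∀ g : Multiplicative (AddAut (geomTorsion W p)),
        Matrix.trace ((Φ g : GL (Fin 2) (ZMod p)) : Matrix (Fin 2) (Fin 2) (ZMod p)) =
          LinearMap.trace (ZMod p) (geomTorsion W p) ((Multiplicative.toAdd g).toAddMonoidHom.toZModLinearMap p))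
    (hGN : (galoisRepTorsion W p).range.map Φ.toMonoidHom ≤
      Subgroup.normalizer (Serre1972.unitGroup k : Set (GL (Fin 2) (ZMod p))))
    (hK2 : Module.finrank ℚ K = 2)
    (hKU : ∀ τ : absoluteGaloisGroup K, Φ (galoisRepTorsion W p (absGaloisRestrict ℚ K τ)) ∈ Serre1972.unitGroup k)
    (𝔪 : Ideal (𝓞 K)) (h𝔪 : 𝔪 ≠ ⊥) (ψ : HeightOneSpectrum (𝓞 K) → ℂ) (e : PadicAlgCl p ≃+* ℂ)
    (hneb : ∀ n : ℕ, Odd n → n.Coprime ((NumberField.discr K).natAbs * Ideal.absNorm 𝔪) →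
      idealPow K ψ (Ideal.span {(n : 𝓞 K)}) = (jacobiSym (NumberField.discr K) n : ℂ) * (n : ℂ) ^ (2 - 1))
    (htrace : ∀ (ℓ : ℕ) [Fact ℓ.Prime], ℓ ≠ p → W.HasGoodReductionAtPrime ℓ →
      ‖e.symm (∑ᶠ (w : HeightOneSpectrum (𝓞 K)) (_ : Ideal.absNorm w.asIdeal = ℓ), ψ w) -
        (W.frobeniusTrace ℓ : PadicAlgCl p)‖ < 1)
    {S : Set (PadicAlgCl p)} [FiniteDimensional ℚ_[p] (padicCoeffField S)] (θ : FramedGaloisRep K (padicCoeffIntegers S) 1)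
    (hθ : ∀ w : HeightOneSpectrum (𝓞 K), (p : 𝓞 K) ∉ w.asIdeal → ¬ 𝔪 ≤ w.asIdeal →
      θ.IsUnramifiedAt w ∧ ∃ P : Polynomial (padicCoeffIntegers S),
        P.map (padicCoeffIntegers S).subtype = Polynomial.X - Polynomial.C (e.symm (ψ w)) ∧ θ.HasFrobCharpolyAt w P)
    (c : absoluteGaloisGroup ℚ) (hc : Φ (galoisRepTorsion W p c) ∉ Serre1972.unitGroup k)
    {R : Type*} [CommRing R] (uK : R → ((W.baseChange K).geomPrimaryTorsion p →+ (W.baseChange K).geomPrimaryTorsion p))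
    (hadd : ∀ (a b : R) (x : (W.baseChange K).geomPrimaryTorsion p), uK (a + b) x = uK a x + uK b x)
    (hmul : ∀ (a b : R) (x : (W.baseChange K).geomPrimaryTorsion p), uK (a * b) x = uK a (uK b x))
    (hone : ∀ x : (W.baseChange K).geomPrimaryTorsion p, uK 1 x = x)
    {E' : Type} [Field E'] [Algebra K E'] (ι : AlgebraicClosure K →ₐ[K] AlgebraicClosure E') (χLT : absoluteGaloisGroup E' → R)
    (hχ : ∀ (δ : absoluteGaloisGroup E') (x : (W.baseChange K).geomPrimaryTorsion p), resGalOfEmb ι δ • x = uK (χLT δ) x)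
    (ιv : R →+* padicCoeffIntegers S)
    (hιv : ∀ δ : absoluteGaloisGroup E', ιv (χLT δ) =
      (((θ (resGalOfEmb ι δ) : GL (Fin 1) (padicCoeffIntegers S)) : Matrix (Fin 1) (Fin 1) (padicCoeffIntegers S)) 0 0))
    (hw : ∃ δ₀ : absoluteGaloisGroup E', ∀ n : ℕ, ∃ x : (W.baseChange K).geomPrimaryTorsion p, p • x = 0 ∧ uK (χLT δ₀) x ≠ n • x)
    (hfaith : ∀ d : R, (∀ x : (W.baseChange K).geomPrimaryTorsion p, p • x = 0 → uK d x = 0) → ∃ d' : R, d = (p : R) * d')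
    {π : padicCoeffIntegers S} (hπ : Irreducible π)
    (Sπ : AddSubgroup (Cofree θ (padicCoeffField S))) (hSπ : ∀ m : Cofree θ (padicCoeffField S), m ∈ Sπ ↔ π • m = 0)
    (s : Cofree θ (padicCoeffField S) →+ (W.baseChange K).geomPrimaryTorsion p)
    (hslin : ∀ (b : R) (m : Cofree θ (padicCoeffField S)), s (ιv b • m) = uK b (s m))
    (g : absoluteGaloisGroup K) (m : Cofree θ (padicCoeffField S)) (hm : m ∈ Sπ) : s (g • m) = g • s m := by
  rw [hSπ] at hm
  obtain ⟨b, hb⟩ := exists_scalar_realising W Φ K h2k e₀ he₀ hKU uK hadd hmul hone ι χLT hχ hw g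
  obtain ⟨t, ht⟩ := Ideal.mem_span_singleton'.1 (residualChar_sub_mem_of_inputs W Φ K hp2 hk h2k e₀ he₀ htr hGN hK2 hKU 𝔪 h𝔪 ψ e hneb
    htrace θ hθ c hc uK hadd hmul hone ι χLT hχ ιv hιv hw hfaith hπ g b hb)
  have hps : p • s m = 0 := by rw [← map_nsmul, nsmul_eq_zero_of_smul_eq_zero_of_irreducible hπ hm, map_zero]
  rw [smul_eq_entry_smul, show (((θ g : GL (Fin 1) (padicCoeffIntegers S)) : Matrix (Fin 1) (Fin 1) (padicCoeffIntegers S)) 0 0) =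
    ιv b + t * π from by rw [ht]; ring, add_smul, mul_smul, hm, smul_zero, add_zero, hslin, hb _ hps]

end Global

end Summit.BirchSwinnertonDyer.BirchSwinnertonDyer.Theorems.SmallImageCharSignedSelmer

end
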